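import Summits.QuantumFields.BalabanUV.T4Continuum.Support.TermRepOfSeries

/-!
# NE5 ∕ U3 — row O1-d3, GENERIC HALF (2): STEP-DEPENDENT TERM LABELS `ι k` flattened to ONE index type, carrying
# `OutIsSeries`, `TermBound`, the weights' budget, `TermLineAnalytic` and `TermRep` over from the fibrewise data
# (claim table `t4/b2b-balaban-t4-ne5-p1/O1-CLAIM-TABLE-NE5-P1.md` row O1-d, parts d1∕d2∕d3)

Cell `pub-balaban`, unit `b2b-balaban-t4-ne5-formalise-leaf-04` (NE5 formalisation swarm, LEAF PROVER 04).  Summits-side new work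
under the LEAN PLACEMENT RULE (cell bookkeeping; NOT a Literature module).  HONEST FRAMING: rung (B)+1 of the FINITE-VOLUME T⁴
continuum programme — NOT infinite volume, NOT a mass gap, NOT the Clay problem, NOT a proof of NE5 (NOT PRINTED in
[Balaban1987RG1]–[Balaban1989LargeFieldII]; they print ε-UNIFORM bounds, never η-RATES).  HONEST DEPENDENCY (cell line, verbatim):
continuum YM on T⁴ ⇐ BetaPertH ∧ nine spine estimates (0/9 proved); BetaPertH ⇐ (D1) ∧ (D4) ∧ CAP+tail; G-an2-4 gates asym, D1
and NE2/3/4.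

WHAT THIS FILE DOES.  Row O1-d1 (leaf-02, journal l.5367) types the labels of the terms of [Balaban1988RG2Cluster] (2.9)∕(2.13)∕
(2.14) as a STEP-DEPENDENT family of index types `ι k` (polymers ∕ tuples of the step-`k` unit lattice) and O1-d2 (leaf-08,
l.5395) sets `Out k := ∑' i : ι k, T k i`.  The termwise hypothesis shapes of `T4InputCauchyRateTermwise` (`TermRep`, `TermBound`,
`TermBudget`, `TermLineAnalytic`) take ONE index type for all steps («terms irrelevant to a given `(k, X)` are zero»).  This file
is the cast-free dictionary between the two, with no estimate anywhere:
* `flatten t k : (Σ k, ι k) → …` = `t k` on the step-`k` fibre, `0` elsewhere (`Function.extend` along `Sigma.mk k`;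
  `flatten_mk`, `flatten_of_ne`); likewise `flattenWt a` for fibrewise weights;
* reindexing: `hasSum_flatten_iff`, `tsum_flatten`, `seriesOut_flatten` (`Function.Injective.hasSum_iff` ∕ `tsum_eq`), hence
  `outIsSeries_flatten` ∕ `outIsSeriesOn_flatten`: d2's fibrewise definition IS `TermRepOfSeries.OutIsSeries M (flatten t)`;
* the displayed termwise binders FLATTEN: `termBound_flatten`, `summable_flattenWt_iff`, `tsum_flattenWt`, `termBudget_flatten`,
  `termLineAnalytic_flatten` — fibrewise data in, the leaf's shapes for `flatten t` ∕ `flattenWt a` out;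
* ROW O1-d3 for step-dependent labels: `termRep_flatten` (fibrewise identification + fibrewise majorant with summable weights ⟹
  `TermRep M K (flatten t) W`, via `TermRepOfSeries.termRep_of_outIsSeriesOn`) and the read-back `hasSum_fibre_of_termRep_flatten`;
* non-vacuity: the termwise leaf's `ℕ`-indexed Taylor toy read as a constant fibre family (`toy_termRep_flatten`).
So whatever index design d1 lands, d3-ii and O2's termwise END faces (`T4InputCauchyRateTermwise.ne5_at_of_stepModel_termwise_*`,
`TermRepOfSeries.ne5_at_of_stepModel_series_slack_budget_scale_nat`) are stated for `flatten t` BY NAME.  The convergence binders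
remain DISPLAYED hypothesis shapes (printed SUPPORT [Balaban1988RG2Cluster] Lemma 3 (2.38) p. 20, (2.41) p. 21 — locators only,
trigger c3∕c4); nothing of the manuscripts under audit is asserted.  0 sorry; no new axioms.
-/

namespace Summit.QuantumFields.BalabanUV.T4Continuum.TermRepFlatten

open Metric
open scoped BigOperators

open Literature.MathematicalPhysics.QuantumFieldTheory.Balaban1983to89.T4OutputRate (Carriers)
open Literature.MathematicalPhysics.QuantumFieldTheory.Balaban1983to89.T4InputCauchyRateData (StepModel)
open Literature.MathematicalPhysics.QuantumFieldTheory.Balaban1983to89.T4InputCauchyRateTermwise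
  (TermRep TermBound TermBudget TermLineAnalytic)
open Summit.QuantumFields.BalabanUV.T4Continuum.TermRepOfSeries
  (seriesOut OutIsSeries OutIsSeriesOn termRep_of_outIsSeriesOn)

variable {C : Carriers} {Op Hist : Type*} {ι : ℕ → Type*}

/-! ## §1 The flattening and its fibre lemmas -/

section Flatten

/-- [folklore] FLATTENING of a step-dependent term family `t k : ι k → …` to the single index type `Σ k, ι k`: at step `k` the
flattened term at label `⟨k', j⟩` is `t k j` if `k' = k` and `0` otherwise (`Function.extend` along the injection `Sigma.mk k`,
no casts).  The convention of `TermRep`'s docstring («terms irrelevant to a given `(k, X)` are zero»). -/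
noncomputable def flatten (t : (k : ℕ) → ι k → Op → Hist → C.Dom → ℂ) : ℕ → (Σ k, ι k) → Op → Hist → C.Dom → ℂ :=
  fun k => Function.extend (Sigma.mk k) (t k) 0

/-- [folklore] The same flattening for fibrewise WEIGHTS `a k : ι k → ℝ`. -/
noncomputable def flattenWt (a : (k : ℕ) → ι k → ℝ) : ℕ → (Σ k, ι k) → ℝ :=
  fun k => Function.extend (Sigma.mk k) (a k) 0

variable {t : (k : ℕ) → ι k → Op → Hist → C.Dom → ℂ} {a : (k : ℕ) → ι k → ℝ}

/-- [folklore] On the step-`k` fibre the flattened term IS the original term. -/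
@[simp] theorem flatten_mk (k : ℕ) (j : ι k) : flatten t k ⟨k, j⟩ = t k j :=
  sigma_mk_injective.extend_apply _ _ _

/-- [folklore] Off the step-`k` fibre the flattened term vanishes. -/
theorem flatten_of_ne {k : ℕ} {i : Σ k, ι k} (hi : i.1 ≠ k) : flatten t k i = 0 := by
  have h : ¬∃ j, Sigma.mk k j = i := fun ⟨j, hj⟩ => hi (by rw [← hj])
  simp only [flatten, Function.extend_apply' _ _ _ h, Pi.zero_apply]

/-- [folklore] Off the RANGE of `Sigma.mk k` the flattened term vanishes (the support form the reindexing lemmas consume). -/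
theorem flatten_of_not_mem_range {k : ℕ} {i : Σ k, ι k} (hi : i ∉ Set.range (Sigma.mk k)) (o : Op) (h : Hist)
    (X : C.Dom) : flatten t k i o h X = 0 := by
  have h' : ¬∃ j, Sigma.mk k j = i := fun ⟨j, hj⟩ => hi ⟨j, hj⟩
  simp only [flatten, Function.extend_apply' _ _ _ h', Pi.zero_apply]

/-- [folklore] On the fibre the flattened weight IS the original weight. -/
@[simp] theorem flattenWt_mk (k : ℕ) (j : ι k) : flattenWt a k ⟨k, j⟩ = a k j :=
  sigma_mk_injective.extend_apply _ _ _

/-- [folklore] Off the range of `Sigma.mk k` the flattened weight vanishes. -/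
theorem flattenWt_of_not_mem_range {k : ℕ} {i : Σ k, ι k} (hi : i ∉ Set.range (Sigma.mk k)) : flattenWt a k i = 0 := by
  have h : ¬∃ j, Sigma.mk k j = i := fun ⟨j, hj⟩ => hi ⟨j, hj⟩
  simp only [flattenWt, Function.extend_apply' _ _ _ h, Pi.zero_apply]

/-! ## §2 Reindexing: `HasSum`, `tsum`, `seriesOut`, `OutIsSeries(On)` -/

/-- [folklore] **REINDEXING `HasSum`**: the flattened family at step `k` has sum `s` iff the fibre family has sum `s`
(`Function.Injective.hasSum_iff` along `Sigma.mk k`). -/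
theorem hasSum_flatten_iff {k : ℕ} {o : Op} {h : Hist} {X : C.Dom} {s : ℂ} :
    HasSum (fun i => flatten t k i o h X) s ↔ HasSum (fun j => t k j o h X) s := by
  rw [← sigma_mk_injective.hasSum_iff (f := fun i => flatten t k i o h X)
    (fun i hi => flatten_of_not_mem_range hi o h X)]
  simp only [Function.comp_def, flatten_mk]

/-- [folklore] **REINDEXING `tsum`**: `∑' i, flatten t k i o h X = ∑' j, t k j o h X` (`Function.Injective.tsum_eq`). -/
theorem tsum_flatten (k : ℕ) (o : Op) (h : Hist) (X : C.Dom) : ∑' i, flatten t k i o h X = ∑' j, t k j o h X := by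
  rw [← sigma_mk_injective.tsum_eq (f := fun i => flatten t k i o h X)
    (fun i hi => by_contra fun hr => hi (flatten_of_not_mem_range hr o h X))]
  simp only [flatten_mk]

/-- [folklore] The series output of the flattened family is the fibrewise series: `seriesOut (flatten t) k o h X = ∑' j, t k j o h X`
— so d2's `Out k o h X := ∑' j : ι k, t k j o h X` IS `seriesOut (flatten t)` pointwise. -/
theorem seriesOut_flatten (k : ℕ) (o : Op) (h : Hist) (X : C.Dom) :
    seriesOut (C := C) (flatten t) k o h X = ∑' j, t k j o h X :=
  tsum_flatten k o h X

variable [NormedAddCommGroup Op] [NormedSpace ℂ Op] [NormedAddCommGroup Hist] [NormedSpace ℂ Hist]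

/-- [folklore] `OutIsSeries` for the flattened family from the FIBREWISE identification (d2's definition read pointwise). -/
theorem outIsSeries_flatten {M : StepModel C Op Hist}
    (hout : ∀ (k : ℕ) (o : Op) (h : Hist) (X : C.Dom), M.Out k o h X = ∑' j, t k j o h X) :
    OutIsSeries M (flatten t) :=
  fun k o h X => (hout k o h X).trans (tsum_flatten k o h X).symm

/-- [folklore] `OutIsSeriesOn` for the flattened family from the fibrewise identification ON THE CLASS. -/
theorem outIsSeriesOn_flatten {M : StepModel C Op Hist} {K : ℕ → (ℕ → ℝ) → C.BgB → Set (Op × Hist)} {W : Set (ℕ → ℝ)}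
    (hout : ∀ k, ∀ g ∈ W, ∀ (U : C.BgB) (q : Op × Hist), q ∈ K k g U → ∀ X : C.Dom, C.scale X = k →
      M.Out k q.1 q.2 X = ∑' j, t k j q.1 q.2 X) : OutIsSeriesOn M (flatten t) K W :=
  fun k g hg U q hq X hX => (hout k g hg U q hq X hX).trans (tsum_flatten k q.1 q.2 X).symm

/-! ## §3 The displayed termwise binders flatten -/

omit [NormedAddCommGroup Op] [NormedSpace ℂ Op] [NormedAddCommGroup Hist] [NormedSpace ℂ Hist] in
/-- [folklore] **`TermBound` FLATTENS**: fibrewise majorants `‖t k j q.1 q.2 X‖ ≤ a k j · e^{−κd(X)}` on the class give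
`TermBound K (flatten t) W κ (flattenWt a)` (off the fibre both sides vanish). -/
theorem termBound_flatten {K : ℕ → (ℕ → ℝ) → C.BgB → Set (Op × Hist)} {W : Set (ℕ → ℝ)} {κ : ℝ}
    (hbd : ∀ k, ∀ g ∈ W, ∀ (U : C.BgB) (q : Op × Hist), q ∈ K k g U → ∀ X : C.Dom, C.scale X = k →
      ∀ j : ι k, ‖t k j q.1 q.2 X‖ ≤ a k j * Real.exp (-(κ * C.d X))) :
    TermBound K (flatten t) W κ (flattenWt a) := by
  intro k g hg U q hq X hX i
  by_cases hi : i ∈ Set.range (Sigma.mk k)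
  · obtain ⟨j, rfl⟩ := hi
    rw [flatten_mk, flattenWt_mk]
    exact hbd k g hg U q hq X hX j
  · rw [flatten_of_not_mem_range hi, flattenWt_of_not_mem_range hi, norm_zero, zero_mul]

omit [NormedAddCommGroup Op] [NormedSpace ℂ Op] [NormedAddCommGroup Hist] [NormedSpace ℂ Hist] in
/-- [folklore] **SUMMABILITY OF THE WEIGHTS FLATTENS** (`Function.Injective.summable_iff`). -/
theorem summable_flattenWt_iff (k : ℕ) : Summable (flattenWt a k) ↔ Summable (a k) := by
  rw [← sigma_mk_injective.summable_iff (f := flattenWt a k) (fun i hi => flattenWt_of_not_mem_range hi)]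
  simp only [Function.comp_def, flattenWt_mk]

omit [NormedAddCommGroup Op] [NormedSpace ℂ Op] [NormedAddCommGroup Hist] [NormedSpace ℂ Hist] in
/-- [folklore] The flattened weights have the fibrewise sum (`Function.Injective.tsum_eq`). -/
theorem tsum_flattenWt (k : ℕ) : ∑' i, flattenWt a k i = ∑' j, a k j := by
  rw [← sigma_mk_injective.tsum_eq (f := flattenWt a k)
    (fun i hi => by_contra fun hr => hi (flattenWt_of_not_mem_range hr))]
  simp only [flattenWt_mk]

omit [NormedAddCommGroup Op] [NormedSpace ℂ Op] [NormedAddCommGroup Hist] [NormedSpace ℂ Hist] in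
/-- [folklore] **`TermBudget` FLATTENS**: fibrewise `Summable (a k) ∧ ∑' j, a k j ≤ G` for every `k` gives
`TermBudget (flattenWt a) G`. -/
theorem termBudget_flatten {G : ℝ} (hbud : ∀ k, Summable (a k) ∧ ∑' j, a k j ≤ G) :
    TermBudget (ι := Σ k, ι k) (flattenWt a) G :=
  fun k => ⟨(summable_flattenWt_iff k).2 (hbud k).1, (tsum_flattenWt k).le.trans (hbud k).2⟩

/-- [folklore] **`TermLineAnalytic` FLATTENS**: fibrewise complex differentiability of every term along admissible segments gives
it for the flattened family (off the fibre the term is the zero function). -/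
theorem termLineAnalytic_flatten {K : ℕ → (ℕ → ℝ) → C.BgB → Set (Op × Hist)} {W : Set (ℕ → ℝ)}
    (hline : ∀ k, ∀ g ∈ W, ∀ (U : C.BgB) (o u : Op) (h v : Hist),
      (∀ ζ ∈ closedBall (0 : ℂ) 1, (o + ζ • u, h + ζ • v) ∈ K k g U) → ∀ X : C.Dom, C.scale X = k →
        ∀ j : ι k, DifferentiableOn ℂ (fun ζ : ℂ => t k j (o + ζ • u) (h + ζ • v) X) (closedBall 0 1)) :
    TermLineAnalytic K (flatten t) W := by
  intro k g hg U o u h v hseg X hX i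
  by_cases hi : i ∈ Set.range (Sigma.mk k)
  · obtain ⟨j, rfl⟩ := hi
    simp only [flatten_mk]
    exact hline k g hg U o u h v hseg X hX j
  · simp only [flatten_of_not_mem_range hi]
    exact differentiableOn_const 0

/-! ## §4 Row O1-d3 for step-dependent labels -/

/-- [folklore] **ROW O1-d3 FOR STEP-DEPENDENT LABELS.**  If on the class the model's output is the fibrewise series
`M.Out k q.1 q.2 X = ∑' j : ι k, t k j q.1 q.2 X` and the fibrewise terms carry a displayed majorant with summable weights, then
`TermRep M K (flatten t) W` — the termwise route's representation hypothesis for the flattened family, which is the `T` to hand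
to `T4InputCauchyRateTermwise` together with `termBound_flatten` ∕ `termBudget_flatten` ∕ `termLineAnalytic_flatten`. -/
theorem termRep_flatten {M : StepModel C Op Hist} {K : ℕ → (ℕ → ℝ) → C.BgB → Set (Op × Hist)} {W : Set (ℕ → ℝ)}
    {κ : ℝ}
    (hout : ∀ k, ∀ g ∈ W, ∀ (U : C.BgB) (q : Op × Hist), q ∈ K k g U → ∀ X : C.Dom, C.scale X = k →
      M.Out k q.1 q.2 X = ∑' j, t k j q.1 q.2 X)
    (hbd : ∀ k, ∀ g ∈ W, ∀ (U : C.BgB) (q : Op × Hist), q ∈ K k g U → ∀ X : C.Dom, C.scale X = k →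
      ∀ j : ι k, ‖t k j q.1 q.2 X‖ ≤ a k j * Real.exp (-(κ * C.d X)))
    (ha : ∀ k, Summable (a k)) : TermRep M K (flatten t) W :=
  termRep_of_outIsSeriesOn (outIsSeriesOn_flatten hout) (termBound_flatten hbd)
    fun k => (summable_flattenWt_iff k).2 (ha k)

/-- [folklore] … and conversely `TermRep` for the flattened family gives the FIBREWISE `HasSum` at every class point
(`hasSum_flatten_iff`), i.e. d2's definition read back. -/
theorem hasSum_fibre_of_termRep_flatten {M : StepModel C Op Hist} {K : ℕ → (ℕ → ℝ) → C.BgB → Set (Op × Hist)}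
    {W : Set (ℕ → ℝ)} (hrep : TermRep M K (flatten t) W) {k : ℕ} {g : ℕ → ℝ} (hg : g ∈ W) (U : C.BgB)
    {q : Op × Hist} (hq : q ∈ K k g U) {X : C.Dom} (hX : C.scale X = k) :
    HasSum (fun j => t k j q.1 q.2 X) (M.Out k q.1 q.2 X) :=
  hasSum_flatten_iff.1 (hrep k g hg U q hq X hX)

end Flatten

/-! ## §5 Non-vacuity: the termwise toy's `ℕ`-indexed Taylor family as the constant fibre family `ι k := ℕ` -/

section Toy

open Literature.MathematicalPhysics.QuantumFieldTheory.Balaban1983to89.T4InputCauchyRate (toyCarriers)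
open Literature.MathematicalPhysics.QuantumFieldTheory.Balaban1983to89.T4InputCauchyRateSpecies (toyCtr ballClass)
open Literature.MathematicalPhysics.QuantumFieldTheory.Balaban1983to89.T4InputCauchyRateTermwise
  (toyModelER toyTermE toyMajE hasSum_expSeries_sub_one toyE_termBound toyE_termBudget)

/-- [folklore] The toy's Taylor family read as a (constant) step-dependent family `k ↦ (ℕ ∋ i ↦ toyTermE k i)`. -/
noncomputable def toyFibre : (k : ℕ) → (fun _ : ℕ => ℕ) k → ℂ → ℂ → toyCarriers.Dom → ℂ := fun k i => toyTermE k i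

/-- [folklore] Toy: the flattened Taylor family represents `exp(o + h) − 1` on the leaf's ball class — `termRep_flatten` fed with
the toy's pointwise series identity and the leaf's OWN fibrewise majorant (`toyE_termBound`, `toyE_termBudget`). -/
theorem toy_termRep_flatten :
    TermRep toyModelER (ballClass toyCtr (fun _ => 5 / 32) fun _ => 9 / 4) (flatten toyFibre) Set.univ :=
  termRep_flatten (a := toyMajE)
    (fun _ _ _ _ q _ _ _ => ((hasSum_expSeries_sub_one (q.1 + q.2)).tsum_eq).symm)
    (fun k g hg U q hq X hX j => toyE_termBound k g hg U q hq X hX j) fun k => (toyE_termBudget k).1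

end Toy

end Summit.QuantumFields.BalabanUV.T4Continuum.TermRepFlatten
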